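import Literature.NumberTheory.EllipticCurves.RootNumberTableTwo
import HarnessLib

/-!
# Reading the Kellock–Dokchitser `ℚ₂` table on factored invariants `2^a · (odd)`

Companion to `Literature.NumberTheory.EllipticCurves.RootNumberTableTwo` (Kellock–Dokchitser 2023,
§5, the table of `w(E/ℚ₂)`): the lemmas by which the table is read in practice on a Weierstrass
equation over `ℚ` whose invariants are presented as `c₄ = 2^{a₄} u₄`, `c₆ = 2^{a₆} u₆` (or `0`),
`Δ = 2^{a_Δ} u_Δ` with odd integers `uᵢ` — `KellockDokchitser.w2OfInvariants_two_pow_mul_odd` and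
its `c₆ = 0` / `c₄ = 0` variants reduce `w2OfInvariants` to the pure table `w2Table` at the reduced
triple and the residues `uᵢ mod 64`, after which `decide` evaluates it — and two sanity
evaluations against classical values (`y² = x³ − x`: `w(E/ℚ₂) = −1`; `y² = x³ − 25x`:
`w(E/ℚ₂) = +1`, consistent with `w(E) = −1` for the congruent number `5`).

Source: L. Cowland Kellock, V. Dokchitser, *Root numbers and parity phenomena*, Bull. LMS 55
(2023) = arXiv:2303.07883, Notation 5.1 and §5.
-/

namespace Literature.NumberTheory.EllipticCurves

namespace KellockDokchitser

/-! ### Reading the table on factored invariants `2^a · (odd)` -/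

/-- `v₂(2^a · u) = a` for an odd integer `u`. [folklore] -/
theorem padicValRat_two_pow_mul_odd (a : ℕ) {u : ℤ} (hu : Odd u) :
    padicValRat 2 ((2 : ℚ) ^ a * u) = a := by
  have hu0 : (u : ℚ) ≠ 0 := by
    have : u ≠ 0 := by have := Int.odd_iff.1 hu; omega
    exact_mod_cast this
  have h2 : ((2 : ℚ) ^ a) ≠ 0 := pow_ne_zero _ two_ne_zero
  have hndvd : ¬ ((2 : ℕ) : ℤ) ∣ u := fun h => Int.not_even_iff_odd.2 hu (even_iff_two_dvd.2 h)
  have h22 : padicValRat 2 (2 : ℚ) = 1 := padicValRat.self one_lt_two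
  rw [padicValRat.mul h2 hu0, padicValRat.pow, padicValRat.of_int,
    padicValInt.eq_zero_of_not_dvd hndvd, h22]
  simp

/-- `val2 (2^a · u) = a` for an odd integer `u`. [folklore] -/
theorem val2_two_pow_mul_odd (a : ℕ) {u : ℤ} (hu : Odd u) :
    val2 ((2 : ℚ) ^ a * u) = ((a : ℤ) : WithTop ℤ) := by
  have hu0 : (u : ℚ) ≠ 0 := by
    have : u ≠ 0 := by have := Int.odd_iff.1 hu; omega
    exact_mod_cast this
  unfold val2
  rw [if_neg (mul_ne_zero (pow_ne_zero _ two_ne_zero) hu0), padicValRat_two_pow_mul_odd a hu]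

/-- The odd part of `2^a · u` is `u` for an odd integer `u`. [folklore] -/
theorem oddPart_two_pow_mul_odd (a : ℕ) {u : ℤ} (hu : Odd u) :
    oddPart ((2 : ℚ) ^ a * u) = u := by
  unfold oddPart
  rw [padicValRat_two_pow_mul_odd a hu, zpow_natCast,
    mul_div_cancel_left₀ _ (pow_ne_zero _ two_ne_zero)]

/-- The residue of `2^a · u` fed to the table is `u mod 64` for an odd integer `u`. [folklore] -/
theorem oddRes_two_pow_mul_odd (a : ℕ) {u : ℤ} (hu : Odd u) :
    oddRes ((2 : ℚ) ^ a * u) = u % 64 := by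
  unfold oddRes
  simp [oddPart_two_pow_mul_odd a hu]

/-- THE TABLE ON FACTORED INVARIANTS: if `c₄ = 2^{a₄} u₄`, `c₆ = 2^{a₆} u₆`, `Δ = 2^{a_Δ} u_Δ` with
odd integers `u₄, u₆, u_Δ`, then `w2OfInvariants` is `w2Table` at the reduced triple
`(a_Δ, a₆, a₄) − m·(12, 6, 4)`, `m = shift a_Δ a₆ a₄`, and the residues `uᵢ mod 64` (this is how
the table is read in practice, e.g. on `y² = x³ + 2t x² − x`: `c₄ = 2⁴(4t² + 3)`,
`c₆ = −2⁶ t (8t² + 9)`, `Δ = 2⁶ (t² + 1)`). [cite: KellockDokchitser2023, Notation 5.1] -/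
theorem w2OfInvariants_two_pow_mul_odd (a₄ a₆ aΔ : ℕ) {u₄ u₆ uΔ : ℤ} (h₄ : Odd u₄) (h₆ : Odd u₆)
    (hΔ : Odd uΔ) :
    w2OfInvariants ((2 : ℚ) ^ a₄ * u₄) ((2 : ℚ) ^ a₆ * u₆) ((2 : ℚ) ^ aΔ * uΔ) =
      w2Table ((aΔ : ℤ) - 12 * shift aΔ (a₆ : ℤ) (a₄ : ℤ))
        (((a₆ : ℤ) - 6 * shift aΔ (a₆ : ℤ) (a₄ : ℤ) : ℤ) : WithTop ℤ)
        (((a₄ : ℤ) - 4 * shift aΔ (a₆ : ℤ) (a₄ : ℤ) : ℤ) : WithTop ℤ)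
        (u₄ % 64) (u₆ % 64) (uΔ % 64) := by
  unfold w2OfInvariants
  simp only [val2_two_pow_mul_odd _ h₄, val2_two_pow_mul_odd _ h₆, padicValRat_two_pow_mul_odd _ hΔ,
    oddRes_two_pow_mul_odd _ h₄, oddRes_two_pow_mul_odd _ h₆, oddRes_two_pow_mul_odd _ hΔ,
    WithTop.map_coe]

/-- `val2 0 = ⊤`. [folklore] -/
@[simp] theorem val2_zero : val2 0 = ⊤ := if_pos rfl

/-- `oddRes 0 = 0`. [folklore] -/
@[simp] theorem oddRes_zero : oddRes 0 = 0 := by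
  simp [oddRes, oddPart]

/-- The factored reading when `c₆ = 0` (curves with `j = 1728`, e.g. `y² = x³ − n x`): `C_6 = ⊤`,
all `c_{6,e} = 0`. [cite: KellockDokchitser2023, Notation 5.1] -/
theorem w2OfInvariants_two_pow_mul_odd_of_c₆_eq_zero (a₄ aΔ : ℕ) {u₄ uΔ : ℤ} (h₄ : Odd u₄)
    (hΔ : Odd uΔ) :
    w2OfInvariants ((2 : ℚ) ^ a₄ * u₄) 0 ((2 : ℚ) ^ aΔ * uΔ) =
      w2Table ((aΔ : ℤ) - 12 * shift aΔ ⊤ (a₄ : ℤ)) ⊤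
        (((a₄ : ℤ) - 4 * shift aΔ ⊤ (a₄ : ℤ) : ℤ) : WithTop ℤ) (u₄ % 64) 0 (uΔ % 64) := by
  unfold w2OfInvariants
  simp only [val2_two_pow_mul_odd _ h₄, val2_zero, padicValRat_two_pow_mul_odd _ hΔ,
    oddRes_two_pow_mul_odd _ h₄, oddRes_zero, oddRes_two_pow_mul_odd _ hΔ, WithTop.map_coe,
    WithTop.map_top]

/-- The factored reading when `c₄ = 0` (curves with `j = 0`, e.g. `y² = x³ + b`): `C_4 = ⊤`.
[cite: KellockDokchitser2023, Notation 5.1] -/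
theorem w2OfInvariants_two_pow_mul_odd_of_c₄_eq_zero (a₆ aΔ : ℕ) {u₆ uΔ : ℤ} (h₆ : Odd u₆)
    (hΔ : Odd uΔ) :
    w2OfInvariants 0 ((2 : ℚ) ^ a₆ * u₆) ((2 : ℚ) ^ aΔ * uΔ) =
      w2Table ((aΔ : ℤ) - 12 * shift aΔ (a₆ : ℤ) ⊤)
        (((a₆ : ℤ) - 6 * shift aΔ (a₆ : ℤ) ⊤ : ℤ) : WithTop ℤ) ⊤ 0 (u₆ % 64) (uΔ % 64) := by
  unfold w2OfInvariants
  simp only [val2_two_pow_mul_odd _ h₆, val2_zero, padicValRat_two_pow_mul_odd _ hΔ,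
    oddRes_two_pow_mul_odd _ h₆, oddRes_zero, oddRes_two_pow_mul_odd _ hΔ, WithTop.map_coe,
    WithTop.map_top]

/-- Sanity check on `y² = x³ − x` (`c₄ = 2⁴·3`, `c₆ = 0`, `Δ = 2⁶`; conductor `32`): the table reads
row `(6, ≥7, 4)` with `c₄' ≡ 3 (mod 4)`, `c₄' − 4c_{6,7} = 3 ≢ 7, 11 (mod 16)`, value `−1` — in
agreement with `w(E) = +1 = −w(E/ℚ₂)` for this rank-`0` curve with good reduction outside `2`.
[cite: KellockDokchitser2023, §5 (Table of w(E/ℚ₂))] -/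
theorem w2OfInvariants_example_32a :
    w2OfInvariants ((2 : ℚ) ^ 4 * (3 : ℤ)) 0 ((2 : ℚ) ^ 6 * (1 : ℤ)) = -1 := by
  rw [w2OfInvariants_two_pow_mul_odd_of_c₆_eq_zero 4 6 (by decide) (by decide)]
  decide

/-- Sanity check on `y² = x³ − 25x` (`c₄ = 2⁴·75`, `c₆ = 0`, `Δ = 2⁶·5⁶`): row `(6, ≥7, 4)` with
`c₄' = 75 ≡ 11 (mod 16)`, value `+1` — in agreement with `w(E) = −1` (`5` is a congruent number),
`w(E/ℚ₅) = (−1/5) = +1`, `w(E/ℝ) = −1`. [cite: KellockDokchitser2023, §5 (Table of w(E/ℚ₂))] -/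
theorem w2OfInvariants_example_800 :
    w2OfInvariants ((2 : ℚ) ^ 4 * (75 : ℤ)) 0 ((2 : ℚ) ^ 6 * (15625 : ℤ)) = 1 := by
  rw [w2OfInvariants_two_pow_mul_odd_of_c₆_eq_zero 4 6 (by decide) (by decide)]
  decide

end KellockDokchitser

end Literature.NumberTheory.EllipticCurves
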